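import Summits.RiemannHypothesis.RiemannHypothesis.Theorems.WeilFormatCCinfDoorPoly
import Summits.RiemannHypothesis.RiemannHypothesis.Theorems.WeilFormatCCinfBlockEntries
import Summits.RiemannHypothesis.RiemannHypothesis.Theorems.WeilFormatCDeflatedFarParseval
import HarnessLib

/-!
# Format C, design C∞: the MARGINS `hS` of the front door with every entry resolved into boxable objects

Route context: Fourier–Galerkin / Schur-complement certificates of Weil positivity on a window ("format C", C∞ door;
cell memo `run/shared/lean/pub/rh-explicit/rh-explicit-weil-10/KERNEL-LEVER.md` §21; supporting stmt-RiemannHypothesis-0098;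
seat rh-explicit-weil-10).  The margin hypothesis `hSe` of `weilPositivityOn_of_cinf_poly` is a quadratic form in `(x, β)`
whose entries are written with the PROJECTED profiles `1f_j − proj_B 1f_j` and the far Parseval tail
`E∞(j,j') = Σ_{n>B} V_j(n)V_{j'}(n)`.  Here it is derived from the same inequality with every entry RESOLVED
(`WeilFormatCCinfBlockEntries`, `WeilFormatCDeflatedFarParseval`): the kernel block `M⁺(i,i')`, the full low images
`X_j(i) = Re W(1f_j, w⁺_i)/d_i`, the low profile tables `V_j(n)` (`n ≤ B`), the full entries `Re W(1f_j, 1f_{j'})`, and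
`E∞(j,j') = 2Re∫1f_j·conj(1f_{j'}) − 2c₀c₀′ − Σ_{1≤n≤B} V_j(n)V_{j'}(n)` — all objects with closed forms / boxes in the tree.

* `hS_even_of_entries` — the resolved even margin implies `hSe`;
* `hS_odd_of_entries` — the odd twin (`V⁻(k) = 2 Im ĉ_{k+1}/√(2a)`, `Y_j(i) = Im W(1f_j, w⁻_{i+1})/√2`, `M⁻`; `tsum_oddTable_mul_eq`).

Pure rewriting; standard axioms; no definitions; no RH claim.
-/

set_option autoImplicit false
-- `Summit.RiemannHypothesis.RiemannHypothesis.…` is the layout-mandated namespace (summit = problem name).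
set_option linter.dupNamespace false

noncomputable section

open Complex Filter Set MeasureTheory Finset
open scoped Real Topology ComplexConjugate

namespace Summit.RiemannHypothesis.RiemannHypothesis.Theorems.WeilFormatC

open Literature.NumberTheory.LFunctions Literature.NumberTheory.LFunctions.Yoshida1992

variable {a : ℝ}

/-- **The even margin from resolved entries.**  For polynomial even profiles (even powers, `Σ_q c_q q a^{q−1} = 0`),
the margin inequality with the cross entries `X_j(i) − Σ_{n≤B} M⁺(n,i)V_j(n)`, the profile entries
`Re W(1f_j,1f_{j'}) − Σ_n V_{j'}(n)X_j(n) − Σ_n V_j(n)X_{j'}(n) + Σ_n V_{j'}(n)Σ_{n'} M⁺(n',n)V_j(n')` and the resolved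
`E∞` implies the `hSe` hypothesis of `weilPositivityOn_of_cinf_poly`. -/
theorem hS_even_of_entries (ha : 0 < a) {Be re : ℕ} (se : Finset ℕ) (hse : ∀ q ∈ se, Even q)
    (coefe : Fin re → ℕ → ℝ) (hbe : ∀ j, ∑ q ∈ se, coefe j q * q * a ^ (q - 1) = 0)
    (Λ1e : Fin re → Fin (Be + 1) → ℝ) (Λ2e : Fin re → Fin re → ℝ)
    (Uqe : (Fin (Be + 1) → ℝ) → (Fin re → ℝ) → ℝ) {δe : ℝ}
    (hS : ∀ (x : Fin (Be + 1) → ℝ) (β : Fin re → ℝ),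
      δe * (∑ i, x i ^ 2 + ∑ j, β j ^ 2) ≤
        ((∑ i : Fin (Be + 1), ∑ i' : Fin (Be + 1), x i * x i' *
            (if (i : ℕ) = 0 then gramCoeff a 0 (i' : ℕ) else if (i' : ℕ) = 0 then gramCoeff a (i : ℕ) 0
              else (gramCoeff a (i : ℕ) (i' : ℕ) + gramCoeff a (i : ℕ) (-((i' : ℕ) : ℤ))) / 2))
          + 2 * (∑ i : Fin (Be + 1), ∑ j : Fin re, x i * β j *
            (((weilWindowSesq a ((Icc (-a) a).indicator fun x : ℝ ↦ ∑ q ∈ se, ((coefe j q : ℝ) : ℂ) * ((x : ℂ)) ^ q) (chiEven a (i : ℕ))).re / (if (i : ℕ) = 0 then 1 else Real.sqrt 2))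
              - ∑ n ∈ Finset.range (Be + 1),
                  (if n = 0 then gramCoeff a 0 (i : ℕ) else if (i : ℕ) = 0 then gramCoeff a n 0
              else (gramCoeff a n (i : ℕ) + gramCoeff a n (-((i : ℕ) : ℤ))) / 2) * ((if n = 0 then 1 else 2) * (Yoshida1992.fourierCoeff a n ((Icc (-a) a).indicator fun x : ℝ ↦ ∑ q ∈ se, ((coefe j q : ℝ) : ℂ) * ((x : ℂ)) ^ q)).re / Real.sqrt (2 * a))))
          + (∑ j : Fin re, ∑ j' : Fin re, β j * β j' *
            ((weilWindowSesq a ((Icc (-a) a).indicator (fun x : ℝ ↦ ∑ q ∈ se, ((coefe j q : ℝ) : ℂ) * ((x : ℂ)) ^ q)) ((Icc (-a) a).indicator (fun x : ℝ ↦ ∑ q ∈ se, ((coefe j' q : ℝ) : ℂ) * ((x : ℂ)) ^ q))).re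
              - ∑ n ∈ Finset.range (Be + 1), ((if n = 0 then 1 else 2) * (Yoshida1992.fourierCoeff a n ((Icc (-a) a).indicator fun x : ℝ ↦ ∑ q ∈ se, ((coefe j' q : ℝ) : ℂ) * ((x : ℂ)) ^ q)).re / Real.sqrt (2 * a)) * ((weilWindowSesq a ((Icc (-a) a).indicator fun x : ℝ ↦ ∑ q ∈ se, ((coefe j q : ℝ) : ℂ) * ((x : ℂ)) ^ q) (chiEven a n)).re / (if n = 0 then 1 else Real.sqrt 2))
              - ∑ n ∈ Finset.range (Be + 1), ((if n = 0 then 1 else 2) * (Yoshida1992.fourierCoeff a n ((Icc (-a) a).indicator fun x : ℝ ↦ ∑ q ∈ se, ((coefe j q : ℝ) : ℂ) * ((x : ℂ)) ^ q)).re / Real.sqrt (2 * a)) * ((weilWindowSesq a ((Icc (-a) a).indicator fun x : ℝ ↦ ∑ q ∈ se, ((coefe j' q : ℝ) : ℂ) * ((x : ℂ)) ^ q) (chiEven a n)).re / (if n = 0 then 1 else Real.sqrt 2))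
              + ∑ n ∈ Finset.range (Be + 1), ((if n = 0 then 1 else 2) * (Yoshida1992.fourierCoeff a n ((Icc (-a) a).indicator fun x : ℝ ↦ ∑ q ∈ se, ((coefe j' q : ℝ) : ℂ) * ((x : ℂ)) ^ q)).re / Real.sqrt (2 * a)) *
                  ∑ n' ∈ Finset.range (Be + 1), (if n' = 0 then gramCoeff a 0 n else if n = 0 then gramCoeff a n' 0
              else (gramCoeff a n' n + gramCoeff a n' (-(n : ℤ))) / 2) * ((if n' = 0 then 1 else 2) * (Yoshida1992.fourierCoeff a n' ((Icc (-a) a).indicator fun x : ℝ ↦ ∑ q ∈ se, ((coefe j q : ℝ) : ℂ) * ((x : ℂ)) ^ q)).re / Real.sqrt (2 * a)))))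
        - Uqe x β
        + 2 * ∑ j, (∑ i, Λ1e j i * x i + ∑ j', Λ2e j j' * β j') * (β j - ∑ j',
            ((2 * (∫ x, (Icc (-a) a).indicator (fun x : ℝ ↦ ∑ q ∈ se, ((coefe j q : ℝ) : ℂ) * ((x : ℂ)) ^ q) x * conj ((Icc (-a) a).indicator (fun x : ℝ ↦ ∑ q ∈ se, ((coefe j' q : ℝ) : ℂ) * ((x : ℂ)) ^ q) x)).re
        - 2 * (((Yoshida1992.fourierCoeff a 0 ((Icc (-a) a).indicator fun x : ℝ ↦ ∑ q ∈ se, ((coefe j q : ℝ) : ℂ) * ((x : ℂ)) ^ q)).re / Real.sqrt (2 * a)) *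
            ((Yoshida1992.fourierCoeff a 0 ((Icc (-a) a).indicator fun x : ℝ ↦ ∑ q ∈ se, ((coefe j' q : ℝ) : ℂ) * ((x : ℂ)) ^ q)).re / Real.sqrt (2 * a)))
        - ∑ n ∈ Finset.Ico 1 (Be + 1),
            (2 * (Yoshida1992.fourierCoeff a n ((Icc (-a) a).indicator fun x : ℝ ↦ ∑ q ∈ se, ((coefe j q : ℝ) : ℂ) * ((x : ℂ)) ^ q)).re / Real.sqrt (2 * a)) *
            (2 * (Yoshida1992.fourierCoeff a n ((Icc (-a) a).indicator fun x : ℝ ↦ ∑ q ∈ se, ((coefe j' q : ℝ) : ℂ) * ((x : ℂ)) ^ q)).re / Real.sqrt (2 * a)))) * β j'))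
    (x : Fin (Be + 1) → ℝ) (β : Fin re → ℝ) :
    δe * (∑ i, x i ^ 2 + ∑ j, β j ^ 2) ≤
        ((∑ i : Fin (Be + 1), ∑ i' : Fin (Be + 1), x i * x i' *
            (if (i : ℕ) = 0 then gramCoeff a 0 i' else if (i' : ℕ) = 0 then gramCoeff a i 0
              else (gramCoeff a i i' + gramCoeff a i (-(i' : ℤ))) / 2))
          + 2 * (∑ i : Fin (Be + 1), ∑ j : Fin re, x i * β j *
            ((weilWindowSesq a ((Icc (-a) a).indicator (fun x : ℝ ↦ ∑ q ∈ se, ((coefe j q : ℝ) : ℂ) * ((x : ℂ)) ^ q)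
              - proj a Be ((Icc (-a) a).indicator fun x : ℝ ↦ ∑ q ∈ se, ((coefe j q : ℝ) : ℂ) * ((x : ℂ)) ^ q))
              (chiEven a i)).re / (if (i : ℕ) = 0 then 1 else Real.sqrt 2)))
          + (∑ j : Fin re, ∑ j' : Fin re, β j * β j' *
            (weilWindowSesq a ((Icc (-a) a).indicator (fun x : ℝ ↦ ∑ q ∈ se, ((coefe j q : ℝ) : ℂ) * ((x : ℂ)) ^ q)
                - proj a Be ((Icc (-a) a).indicator fun x : ℝ ↦ ∑ q ∈ se, ((coefe j q : ℝ) : ℂ) * ((x : ℂ)) ^ q))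
              ((Icc (-a) a).indicator (fun x : ℝ ↦ ∑ q ∈ se, ((coefe j' q : ℝ) : ℂ) * ((x : ℂ)) ^ q)
                - proj a Be ((Icc (-a) a).indicator fun x : ℝ ↦ ∑ q ∈ se, ((coefe j' q : ℝ) : ℂ) * ((x : ℂ)) ^ q))).re))
        - Uqe x β
        + 2 * ∑ j, (∑ i, Λ1e j i * x i + ∑ j', Λ2e j j' * β j') * (β j - ∑ j', (∑' n : ℕ, if Be + 1 ≤ n then
                ((if n = 0 then 1 else 2) * (Yoshida1992.fourierCoeff a n ((Icc (-a) a).indicator fun x : ℝ ↦ ∑ q ∈ se, ((coefe j q : ℝ) : ℂ) * ((x : ℂ)) ^ q)).re / Real.sqrt (2 * a)) *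
                ((if n = 0 then 1 else 2) * (Yoshida1992.fourierCoeff a n ((Icc (-a) a).indicator fun x : ℝ ↦ ∑ q ∈ se, ((coefe j' q : ℝ) : ℂ) * ((x : ℂ)) ^ q)).re / Real.sqrt (2 * a)) else 0) * β j') := by
  have hev : ∀ j : Fin re, ∀ x : ℝ, (fun x : ℝ ↦ ∑ q ∈ se, ((coefe j q : ℝ) : ℂ) * ((x : ℂ)) ^ q) (-x) = (fun x : ℝ ↦ ∑ q ∈ se, ((coefe j q : ℝ) : ℂ) * ((x : ℂ)) ^ q) x := fun j ↦ (poly_even_real se (coefe j) hse).1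
  have hre : ∀ j : Fin re, ∀ x : ℝ, conj ((fun x : ℝ ↦ ∑ q ∈ se, ((coefe j q : ℝ) : ℂ) * ((x : ℂ)) ^ q) x) = (fun x : ℝ ↦ ∑ q ∈ se, ((coefe j q : ℝ) : ℂ) * ((x : ℂ)) ^ q) x := fun j ↦ (poly_even_real se (coefe j) hse).2
  have hevI : ∀ j : Fin re, ∀ x : ℝ, (Icc (-a) a).indicator (fun x : ℝ ↦ ∑ q ∈ se, ((coefe j q : ℝ) : ℂ) * ((x : ℂ)) ^ q) (-x) = (Icc (-a) a).indicator (fun x : ℝ ↦ ∑ q ∈ se, ((coefe j q : ℝ) : ℂ) * ((x : ℂ)) ^ q) x :=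
    fun j ↦ indicator_even (f := fun x : ℝ ↦ ∑ q ∈ se, ((coefe j q : ℝ) : ℂ) * ((x : ℂ)) ^ q) (hev j) a
  have hreI : ∀ j : Fin re, ∀ x : ℝ, conj ((Icc (-a) a).indicator (fun x : ℝ ↦ ∑ q ∈ se, ((coefe j q : ℝ) : ℂ) * ((x : ℂ)) ^ q) x) = (Icc (-a) a).indicator (fun x : ℝ ↦ ∑ q ∈ se, ((coefe j q : ℝ) : ℂ) * ((x : ℂ)) ^ q) x :=
    fun j ↦ indicator_real (f := fun x : ℝ ↦ ∑ q ∈ se, ((coefe j q : ℝ) : ℂ) * ((x : ℂ)) ^ q) (hre j) a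
  have hwin : ∀ j : Fin re, IsWindowFunction a ((Icc (-a) a).indicator (fun x : ℝ ↦ ∑ q ∈ se, ((coefe j q : ℝ) : ℂ) * ((x : ℂ)) ^ q)) :=
    fun j ↦ isWindowFunction_indicator_poly a se _
  -- cross entries
  have hX : ∀ (j : Fin re) (i : Fin (Be + 1)),
      (weilWindowSesq a ((Icc (-a) a).indicator (fun x : ℝ ↦ ∑ q ∈ se, ((coefe j q : ℝ) : ℂ) * ((x : ℂ)) ^ q) - proj a Be ((Icc (-a) a).indicator fun x : ℝ ↦ ∑ q ∈ se, ((coefe j q : ℝ) : ℂ) * ((x : ℂ)) ^ q))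
          (chiEven a i)).re / (if (i : ℕ) = 0 then 1 else Real.sqrt 2)
        = ((weilWindowSesq a ((Icc (-a) a).indicator fun x : ℝ ↦ ∑ q ∈ se, ((coefe j q : ℝ) : ℂ) * ((x : ℂ)) ^ q) (chiEven a (i : ℕ))).re / (if (i : ℕ) = 0 then 1 else Real.sqrt 2))
          - ∑ n ∈ Finset.range (Be + 1), (if n = 0 then gramCoeff a 0 (i : ℕ) else if (i : ℕ) = 0 then gramCoeff a n 0
              else (gramCoeff a n (i : ℕ) + gramCoeff a n (-((i : ℕ) : ℤ))) / 2) * ((if n = 0 then 1 else 2) * (Yoshida1992.fourierCoeff a n ((Icc (-a) a).indicator fun x : ℝ ↦ ∑ q ∈ se, ((coefe j q : ℝ) : ℂ) * ((x : ℂ)) ^ q)).re / Real.sqrt (2 * a)) :=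
    fun j i ↦ re_weilWindowSesq_sub_proj_chiEven_div_all ha (hevI j) (hreI j) (hwin j) Be i
  -- profile × profile entries
  have hP : ∀ (j j' : Fin re),
      (weilWindowSesq a ((Icc (-a) a).indicator (fun x : ℝ ↦ ∑ q ∈ se, ((coefe j q : ℝ) : ℂ) * ((x : ℂ)) ^ q) - proj a Be ((Icc (-a) a).indicator fun x : ℝ ↦ ∑ q ∈ se, ((coefe j q : ℝ) : ℂ) * ((x : ℂ)) ^ q))
          ((Icc (-a) a).indicator (fun x : ℝ ↦ ∑ q ∈ se, ((coefe j' q : ℝ) : ℂ) * ((x : ℂ)) ^ q) - proj a Be ((Icc (-a) a).indicator fun x : ℝ ↦ ∑ q ∈ se, ((coefe j' q : ℝ) : ℂ) * ((x : ℂ)) ^ q))).re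
        = (weilWindowSesq a ((Icc (-a) a).indicator (fun x : ℝ ↦ ∑ q ∈ se, ((coefe j q : ℝ) : ℂ) * ((x : ℂ)) ^ q)) ((Icc (-a) a).indicator (fun x : ℝ ↦ ∑ q ∈ se, ((coefe j' q : ℝ) : ℂ) * ((x : ℂ)) ^ q))).re
          - ∑ n ∈ Finset.range (Be + 1), ((if n = 0 then 1 else 2) * (Yoshida1992.fourierCoeff a n ((Icc (-a) a).indicator fun x : ℝ ↦ ∑ q ∈ se, ((coefe j' q : ℝ) : ℂ) * ((x : ℂ)) ^ q)).re / Real.sqrt (2 * a)) * ((weilWindowSesq a ((Icc (-a) a).indicator fun x : ℝ ↦ ∑ q ∈ se, ((coefe j q : ℝ) : ℂ) * ((x : ℂ)) ^ q) (chiEven a n)).re / (if n = 0 then 1 else Real.sqrt 2))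
          - ∑ n ∈ Finset.range (Be + 1), ((if n = 0 then 1 else 2) * (Yoshida1992.fourierCoeff a n ((Icc (-a) a).indicator fun x : ℝ ↦ ∑ q ∈ se, ((coefe j q : ℝ) : ℂ) * ((x : ℂ)) ^ q)).re / Real.sqrt (2 * a)) * ((weilWindowSesq a ((Icc (-a) a).indicator fun x : ℝ ↦ ∑ q ∈ se, ((coefe j' q : ℝ) : ℂ) * ((x : ℂ)) ^ q) (chiEven a n)).re / (if n = 0 then 1 else Real.sqrt 2))
          + ∑ n ∈ Finset.range (Be + 1), ((if n = 0 then 1 else 2) * (Yoshida1992.fourierCoeff a n ((Icc (-a) a).indicator fun x : ℝ ↦ ∑ q ∈ se, ((coefe j' q : ℝ) : ℂ) * ((x : ℂ)) ^ q)).re / Real.sqrt (2 * a)) *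
              ∑ n' ∈ Finset.range (Be + 1), (if n' = 0 then gramCoeff a 0 n else if n = 0 then gramCoeff a n' 0
              else (gramCoeff a n' n + gramCoeff a n' (-(n : ℤ))) / 2) * ((if n' = 0 then 1 else 2) * (Yoshida1992.fourierCoeff a n' ((Icc (-a) a).indicator fun x : ℝ ↦ ∑ q ∈ se, ((coefe j q : ℝ) : ℂ) * ((x : ℂ)) ^ q)).re / Real.sqrt (2 * a)) :=
    fun j j' ↦ re_weilWindowSesq_band_band_even ha (hevI j) (hreI j) (hwin j) (hevI j') (hreI j') (hwin j') Be
  -- the far Parseval tail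
  have hE : ∀ (j j' : Fin re),
      (∑' n : ℕ, if Be + 1 ≤ n then ((if n = 0 then 1 else 2) * (Yoshida1992.fourierCoeff a n ((Icc (-a) a).indicator fun x : ℝ ↦ ∑ q ∈ se, ((coefe j q : ℝ) : ℂ) * ((x : ℂ)) ^ q)).re / Real.sqrt (2 * a)) * ((if n = 0 then 1 else 2) * (Yoshida1992.fourierCoeff a n ((Icc (-a) a).indicator fun x : ℝ ↦ ∑ q ∈ se, ((coefe j' q : ℝ) : ℂ) * ((x : ℂ)) ^ q)).re / Real.sqrt (2 * a)) else 0) = (2 * (∫ x, (Icc (-a) a).indicator (fun x : ℝ ↦ ∑ q ∈ se, ((coefe j q : ℝ) : ℂ) * ((x : ℂ)) ^ q) x * conj ((Icc (-a) a).indicator (fun x : ℝ ↦ ∑ q ∈ se, ((coefe j' q : ℝ) : ℂ) * ((x : ℂ)) ^ q) x)).re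
        - 2 * (((Yoshida1992.fourierCoeff a 0 ((Icc (-a) a).indicator fun x : ℝ ↦ ∑ q ∈ se, ((coefe j q : ℝ) : ℂ) * ((x : ℂ)) ^ q)).re / Real.sqrt (2 * a)) *
            ((Yoshida1992.fourierCoeff a 0 ((Icc (-a) a).indicator fun x : ℝ ↦ ∑ q ∈ se, ((coefe j' q : ℝ) : ℂ) * ((x : ℂ)) ^ q)).re / Real.sqrt (2 * a)))
        - ∑ n ∈ Finset.Ico 1 (Be + 1),
            (2 * (Yoshida1992.fourierCoeff a n ((Icc (-a) a).indicator fun x : ℝ ↦ ∑ q ∈ se, ((coefe j q : ℝ) : ℂ) * ((x : ℂ)) ^ q)).re / Real.sqrt (2 * a)) *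
            (2 * (Yoshida1992.fourierCoeff a n ((Icc (-a) a).indicator fun x : ℝ ↦ ∑ q ∈ se, ((coefe j' q : ℝ) : ℂ) * ((x : ℂ)) ^ q)).re / Real.sqrt (2 * a))) :=
    fun j j' ↦ tsum_evenTable_mul_eq ha (poly_contDiff se (coefe j)) (hev j) (hre j)
      (deriv_poly_even_boundary a se (coefe j) hse (hbe j)) (poly_contDiff se (coefe j')) (hev j') (hre j')
      (deriv_poly_even_boundary a se (coefe j') hse (hbe j')) Be
  simp only [hX, hP, hE]
  exact hS x β

/-! ## The odd margin -/

/-- **The odd margin from resolved entries** (odd powers, `Σ_q c_q a^q = 0`): cross entries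
`Y_j(i) − Σ_{k<B} M⁻(k,i)V⁻_j(k)` (`Y_j(i) = Im W(1f_j, w⁻_{i+1})/√2`), profile entries
`Re W(1f_j,1f_{j'}) − Σ_k V⁻_{j'}(k)Y_j(k) − Σ_k V⁻_j(k)Y_{j'}(k) + Σ_k V⁻_{j'}(k)Σ_{k'} M⁻(k',k)V⁻_j(k')`, and
`E∞(j,j') = 2Re∫1f_j·conj(1f_{j'}) − Σ_{k<B} V⁻_j(k)V⁻_{j'}(k)` imply the `hSo` hypothesis of `weilPositivityOn_of_cinf_poly`. -/
theorem hS_odd_of_entries (ha : 0 < a) {Bo ro : ℕ} (so : Finset ℕ) (hso : ∀ q ∈ so, Odd q)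
    (coefo : Fin ro → ℕ → ℝ) (hbo : ∀ j, ∑ q ∈ so, coefo j q * a ^ q = 0)
    (Λ1o : Fin ro → Fin Bo → ℝ) (Λ2o : Fin ro → Fin ro → ℝ)
    (Uqo : (Fin Bo → ℝ) → (Fin ro → ℝ) → ℝ) {δo : ℝ}
    (hS : ∀ (x : Fin Bo → ℝ) (β : Fin ro → ℝ),
      δo * (∑ i, x i ^ 2 + ∑ j, β j ^ 2) ≤
        ((∑ i : Fin Bo, ∑ i' : Fin Bo, x i * x i' *
            ((gramCoeff a (((i : ℕ) : ℤ) + 1) (((i' : ℕ) : ℤ) + 1)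
              - gramCoeff a (((i : ℕ) : ℤ) + 1) (-((((i' : ℕ) : ℤ)) + 1))) / 2))
          + 2 * (∑ i : Fin Bo, ∑ j : Fin ro, x i * β j *
            (((weilWindowSesq a ((Icc (-a) a).indicator fun x : ℝ ↦ ∑ q ∈ so, ((coefo j q : ℝ) : ℂ) * ((x : ℂ)) ^ q) (chiOdd a ((i : ℕ) + 1))).im / Real.sqrt 2)
              - ∑ k ∈ Finset.Ico 0 Bo, ((gramCoeff a ((k : ℤ) + 1) (((i : ℕ) : ℤ) + 1) - gramCoeff a ((k : ℤ) + 1) (-(((i : ℕ) : ℤ) + 1))) / 2) * (2 * (Yoshida1992.fourierCoeff a ((k : ℤ) + 1) ((Icc (-a) a).indicator fun x : ℝ ↦ ∑ q ∈ so, ((coefo j q : ℝ) : ℂ) * ((x : ℂ)) ^ q)).im / Real.sqrt (2 * a))))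
          + (∑ j : Fin ro, ∑ j' : Fin ro, β j * β j' *
            ((weilWindowSesq a ((Icc (-a) a).indicator (fun x : ℝ ↦ ∑ q ∈ so, ((coefo j q : ℝ) : ℂ) * ((x : ℂ)) ^ q)) ((Icc (-a) a).indicator (fun x : ℝ ↦ ∑ q ∈ so, ((coefo j' q : ℝ) : ℂ) * ((x : ℂ)) ^ q))).re
              - ∑ k ∈ Finset.Ico 0 Bo, (2 * (Yoshida1992.fourierCoeff a ((k : ℤ) + 1) ((Icc (-a) a).indicator fun x : ℝ ↦ ∑ q ∈ so, ((coefo j' q : ℝ) : ℂ) * ((x : ℂ)) ^ q)).im / Real.sqrt (2 * a)) * ((weilWindowSesq a ((Icc (-a) a).indicator fun x : ℝ ↦ ∑ q ∈ so, ((coefo j q : ℝ) : ℂ) * ((x : ℂ)) ^ q) (chiOdd a (k + 1))).im / Real.sqrt 2)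
              - ∑ k ∈ Finset.Ico 0 Bo, (2 * (Yoshida1992.fourierCoeff a ((k : ℤ) + 1) ((Icc (-a) a).indicator fun x : ℝ ↦ ∑ q ∈ so, ((coefo j q : ℝ) : ℂ) * ((x : ℂ)) ^ q)).im / Real.sqrt (2 * a)) * ((weilWindowSesq a ((Icc (-a) a).indicator fun x : ℝ ↦ ∑ q ∈ so, ((coefo j' q : ℝ) : ℂ) * ((x : ℂ)) ^ q) (chiOdd a (k + 1))).im / Real.sqrt 2)
              + ∑ k ∈ Finset.Ico 0 Bo, (2 * (Yoshida1992.fourierCoeff a ((k : ℤ) + 1) ((Icc (-a) a).indicator fun x : ℝ ↦ ∑ q ∈ so, ((coefo j' q : ℝ) : ℂ) * ((x : ℂ)) ^ q)).im / Real.sqrt (2 * a)) *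
                  ∑ k' ∈ Finset.Ico 0 Bo, ((gramCoeff a ((k' : ℤ) + 1) ((k : ℤ) + 1) - gramCoeff a ((k' : ℤ) + 1) (-((k : ℤ) + 1))) / 2) * (2 * (Yoshida1992.fourierCoeff a ((k' : ℤ) + 1) ((Icc (-a) a).indicator fun x : ℝ ↦ ∑ q ∈ so, ((coefo j q : ℝ) : ℂ) * ((x : ℂ)) ^ q)).im / Real.sqrt (2 * a)))))
        - Uqo x β
        + 2 * ∑ j, (∑ i, Λ1o j i * x i + ∑ j', Λ2o j j' * β j') * (β j - ∑ j',
            ((2 * (∫ x, (Icc (-a) a).indicator (fun x : ℝ ↦ ∑ q ∈ so, ((coefo j q : ℝ) : ℂ) * ((x : ℂ)) ^ q) x * conj ((Icc (-a) a).indicator (fun x : ℝ ↦ ∑ q ∈ so, ((coefo j' q : ℝ) : ℂ) * ((x : ℂ)) ^ q) x)).re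
        - ∑ k ∈ Finset.range Bo, (2 * (Yoshida1992.fourierCoeff a ((k : ℤ) + 1) ((Icc (-a) a).indicator fun x : ℝ ↦ ∑ q ∈ so, ((coefo j q : ℝ) : ℂ) * ((x : ℂ)) ^ q)).im / Real.sqrt (2 * a)) * (2 * (Yoshida1992.fourierCoeff a ((k : ℤ) + 1) ((Icc (-a) a).indicator fun x : ℝ ↦ ∑ q ∈ so, ((coefo j' q : ℝ) : ℂ) * ((x : ℂ)) ^ q)).im / Real.sqrt (2 * a)))) * β j'))
    (x : Fin Bo → ℝ) (β : Fin ro → ℝ) :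
    δo * (∑ i, x i ^ 2 + ∑ j, β j ^ 2) ≤
        ((∑ i : Fin Bo, ∑ i' : Fin Bo, x i * x i' *
            ((gramCoeff a (((i : ℕ) : ℤ) + 1) (((i' : ℕ) : ℤ) + 1)
              - gramCoeff a (((i : ℕ) : ℤ) + 1) (-((((i' : ℕ) : ℤ)) + 1))) / 2))
          + 2 * (∑ i : Fin Bo, ∑ j : Fin ro, x i * β j *
            ((weilWindowSesq a ((Icc (-a) a).indicator (fun x : ℝ ↦ ∑ q ∈ so, ((coefo j q : ℝ) : ℂ) * ((x : ℂ)) ^ q)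
                - proj a Bo ((Icc (-a) a).indicator fun x : ℝ ↦ ∑ q ∈ so, ((coefo j q : ℝ) : ℂ) * ((x : ℂ)) ^ q))
              (chiOdd a ((i : ℕ) + 1))).im / Real.sqrt 2))
          + (∑ j : Fin ro, ∑ j' : Fin ro, β j * β j' *
            (weilWindowSesq a ((Icc (-a) a).indicator (fun x : ℝ ↦ ∑ q ∈ so, ((coefo j q : ℝ) : ℂ) * ((x : ℂ)) ^ q)
                - proj a Bo ((Icc (-a) a).indicator fun x : ℝ ↦ ∑ q ∈ so, ((coefo j q : ℝ) : ℂ) * ((x : ℂ)) ^ q))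
              ((Icc (-a) a).indicator (fun x : ℝ ↦ ∑ q ∈ so, ((coefo j' q : ℝ) : ℂ) * ((x : ℂ)) ^ q)
                - proj a Bo ((Icc (-a) a).indicator fun x : ℝ ↦ ∑ q ∈ so, ((coefo j' q : ℝ) : ℂ) * ((x : ℂ)) ^ q))).re))
        - Uqo x β
        + 2 * ∑ j, (∑ i, Λ1o j i * x i + ∑ j', Λ2o j j' * β j') * (β j - ∑ j', (∑' n : ℕ, if Bo ≤ n then
                (2 * (Yoshida1992.fourierCoeff a ((n : ℤ) + 1) ((Icc (-a) a).indicator fun x : ℝ ↦ ∑ q ∈ so, ((coefo j q : ℝ) : ℂ) * ((x : ℂ)) ^ q)).im / Real.sqrt (2 * a)) *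
                (2 * (Yoshida1992.fourierCoeff a ((n : ℤ) + 1) ((Icc (-a) a).indicator fun x : ℝ ↦ ∑ q ∈ so, ((coefo j' q : ℝ) : ℂ) * ((x : ℂ)) ^ q)).im / Real.sqrt (2 * a))
                else 0) * β j') := by
  have hod : ∀ j : Fin ro, ∀ x : ℝ, (fun x : ℝ ↦ ∑ q ∈ so, ((coefo j q : ℝ) : ℂ) * ((x : ℂ)) ^ q) (-x) = -(fun x : ℝ ↦ ∑ q ∈ so, ((coefo j q : ℝ) : ℂ) * ((x : ℂ)) ^ q) x := fun j ↦ (poly_odd_real so (coefo j) hso).1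
  have hre : ∀ j : Fin ro, ∀ x : ℝ, conj ((fun x : ℝ ↦ ∑ q ∈ so, ((coefo j q : ℝ) : ℂ) * ((x : ℂ)) ^ q) x) = (fun x : ℝ ↦ ∑ q ∈ so, ((coefo j q : ℝ) : ℂ) * ((x : ℂ)) ^ q) x := fun j ↦ (poly_odd_real so (coefo j) hso).2
  have hodI : ∀ j : Fin ro, ∀ x : ℝ, (Icc (-a) a).indicator (fun x : ℝ ↦ ∑ q ∈ so, ((coefo j q : ℝ) : ℂ) * ((x : ℂ)) ^ q) (-x) = -(Icc (-a) a).indicator (fun x : ℝ ↦ ∑ q ∈ so, ((coefo j q : ℝ) : ℂ) * ((x : ℂ)) ^ q) x :=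
    fun j ↦ indicator_odd (f := fun x : ℝ ↦ ∑ q ∈ so, ((coefo j q : ℝ) : ℂ) * ((x : ℂ)) ^ q) (hod j) a
  have hreI : ∀ j : Fin ro, ∀ x : ℝ, conj ((Icc (-a) a).indicator (fun x : ℝ ↦ ∑ q ∈ so, ((coefo j q : ℝ) : ℂ) * ((x : ℂ)) ^ q) x) = (Icc (-a) a).indicator (fun x : ℝ ↦ ∑ q ∈ so, ((coefo j q : ℝ) : ℂ) * ((x : ℂ)) ^ q) x :=
    fun j ↦ indicator_real (f := fun x : ℝ ↦ ∑ q ∈ so, ((coefo j q : ℝ) : ℂ) * ((x : ℂ)) ^ q) (hre j) a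
  have hwin : ∀ j : Fin ro, IsWindowFunction a ((Icc (-a) a).indicator (fun x : ℝ ↦ ∑ q ∈ so, ((coefo j q : ℝ) : ℂ) * ((x : ℂ)) ^ q)) :=
    fun j ↦ isWindowFunction_indicator_poly a so _
  have hX : ∀ (j : Fin ro) (i : Fin Bo),
      (weilWindowSesq a ((Icc (-a) a).indicator (fun x : ℝ ↦ ∑ q ∈ so, ((coefo j q : ℝ) : ℂ) * ((x : ℂ)) ^ q) - proj a Bo ((Icc (-a) a).indicator fun x : ℝ ↦ ∑ q ∈ so, ((coefo j q : ℝ) : ℂ) * ((x : ℂ)) ^ q))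
          (chiOdd a ((i : ℕ) + 1))).im / Real.sqrt 2
        = ((weilWindowSesq a ((Icc (-a) a).indicator fun x : ℝ ↦ ∑ q ∈ so, ((coefo j q : ℝ) : ℂ) * ((x : ℂ)) ^ q) (chiOdd a ((i : ℕ) + 1))).im / Real.sqrt 2)
          - ∑ k ∈ Finset.Ico 0 Bo, ((gramCoeff a ((k : ℤ) + 1) (((i : ℕ) : ℤ) + 1) - gramCoeff a ((k : ℤ) + 1) (-(((i : ℕ) : ℤ) + 1))) / 2) * (2 * (Yoshida1992.fourierCoeff a ((k : ℤ) + 1) ((Icc (-a) a).indicator fun x : ℝ ↦ ∑ q ∈ so, ((coefo j q : ℝ) : ℂ) * ((x : ℂ)) ^ q)).im / Real.sqrt (2 * a)) :=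
    fun j i ↦ im_weilWindowSesq_sub_proj_chiOdd_div ha (hodI j) (hreI j) (hwin j) Bo i
  have hP : ∀ (j j' : Fin ro),
      (weilWindowSesq a ((Icc (-a) a).indicator (fun x : ℝ ↦ ∑ q ∈ so, ((coefo j q : ℝ) : ℂ) * ((x : ℂ)) ^ q) - proj a Bo ((Icc (-a) a).indicator fun x : ℝ ↦ ∑ q ∈ so, ((coefo j q : ℝ) : ℂ) * ((x : ℂ)) ^ q))
          ((Icc (-a) a).indicator (fun x : ℝ ↦ ∑ q ∈ so, ((coefo j' q : ℝ) : ℂ) * ((x : ℂ)) ^ q) - proj a Bo ((Icc (-a) a).indicator fun x : ℝ ↦ ∑ q ∈ so, ((coefo j' q : ℝ) : ℂ) * ((x : ℂ)) ^ q))).re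
        = (weilWindowSesq a ((Icc (-a) a).indicator (fun x : ℝ ↦ ∑ q ∈ so, ((coefo j q : ℝ) : ℂ) * ((x : ℂ)) ^ q)) ((Icc (-a) a).indicator (fun x : ℝ ↦ ∑ q ∈ so, ((coefo j' q : ℝ) : ℂ) * ((x : ℂ)) ^ q))).re
          - ∑ k ∈ Finset.Ico 0 Bo, (2 * (Yoshida1992.fourierCoeff a ((k : ℤ) + 1) ((Icc (-a) a).indicator fun x : ℝ ↦ ∑ q ∈ so, ((coefo j' q : ℝ) : ℂ) * ((x : ℂ)) ^ q)).im / Real.sqrt (2 * a)) * ((weilWindowSesq a ((Icc (-a) a).indicator fun x : ℝ ↦ ∑ q ∈ so, ((coefo j q : ℝ) : ℂ) * ((x : ℂ)) ^ q) (chiOdd a (k + 1))).im / Real.sqrt 2)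
          - ∑ k ∈ Finset.Ico 0 Bo, (2 * (Yoshida1992.fourierCoeff a ((k : ℤ) + 1) ((Icc (-a) a).indicator fun x : ℝ ↦ ∑ q ∈ so, ((coefo j q : ℝ) : ℂ) * ((x : ℂ)) ^ q)).im / Real.sqrt (2 * a)) * ((weilWindowSesq a ((Icc (-a) a).indicator fun x : ℝ ↦ ∑ q ∈ so, ((coefo j' q : ℝ) : ℂ) * ((x : ℂ)) ^ q) (chiOdd a (k + 1))).im / Real.sqrt 2)
          + ∑ k ∈ Finset.Ico 0 Bo, (2 * (Yoshida1992.fourierCoeff a ((k : ℤ) + 1) ((Icc (-a) a).indicator fun x : ℝ ↦ ∑ q ∈ so, ((coefo j' q : ℝ) : ℂ) * ((x : ℂ)) ^ q)).im / Real.sqrt (2 * a)) *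
              ∑ k' ∈ Finset.Ico 0 Bo, ((gramCoeff a ((k' : ℤ) + 1) ((k : ℤ) + 1) - gramCoeff a ((k' : ℤ) + 1) (-((k : ℤ) + 1))) / 2) * (2 * (Yoshida1992.fourierCoeff a ((k' : ℤ) + 1) ((Icc (-a) a).indicator fun x : ℝ ↦ ∑ q ∈ so, ((coefo j q : ℝ) : ℂ) * ((x : ℂ)) ^ q)).im / Real.sqrt (2 * a)) :=
    fun j j' ↦ re_weilWindowSesq_band_band_odd ha (hodI j) (hreI j) (hwin j) (hodI j') (hreI j') (hwin j') Bo
  have hE : ∀ (j j' : Fin ro),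
      (∑' n : ℕ, if Bo ≤ n then (2 * (Yoshida1992.fourierCoeff a ((n : ℤ) + 1) ((Icc (-a) a).indicator fun x : ℝ ↦ ∑ q ∈ so, ((coefo j q : ℝ) : ℂ) * ((x : ℂ)) ^ q)).im / Real.sqrt (2 * a)) * (2 * (Yoshida1992.fourierCoeff a ((n : ℤ) + 1) ((Icc (-a) a).indicator fun x : ℝ ↦ ∑ q ∈ so, ((coefo j' q : ℝ) : ℂ) * ((x : ℂ)) ^ q)).im / Real.sqrt (2 * a)) else 0) = (2 * (∫ x, (Icc (-a) a).indicator (fun x : ℝ ↦ ∑ q ∈ so, ((coefo j q : ℝ) : ℂ) * ((x : ℂ)) ^ q) x * conj ((Icc (-a) a).indicator (fun x : ℝ ↦ ∑ q ∈ so, ((coefo j' q : ℝ) : ℂ) * ((x : ℂ)) ^ q) x)).re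
        - ∑ k ∈ Finset.range Bo, (2 * (Yoshida1992.fourierCoeff a ((k : ℤ) + 1) ((Icc (-a) a).indicator fun x : ℝ ↦ ∑ q ∈ so, ((coefo j q : ℝ) : ℂ) * ((x : ℂ)) ^ q)).im / Real.sqrt (2 * a)) * (2 * (Yoshida1992.fourierCoeff a ((k : ℤ) + 1) ((Icc (-a) a).indicator fun x : ℝ ↦ ∑ q ∈ so, ((coefo j' q : ℝ) : ℂ) * ((x : ℂ)) ^ q)).im / Real.sqrt (2 * a))) :=
    fun j j' ↦ tsum_oddTable_mul_eq ha (poly_contDiff so (coefo j)) (hod j) (hre j)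
      (poly_odd_apply_self a so (coefo j) (hbo j)) (WeilConverseWindow.deriv_neg_of_odd (hod j) a)
      (poly_contDiff so (coefo j')) (hod j') (hre j')
      (poly_odd_apply_self a so (coefo j') (hbo j')) (WeilConverseWindow.deriv_neg_of_odd (hod j') a) Bo
  simp only [hX, hP, hE]
  exact hS x β

end Summit.RiemannHypothesis.RiemannHypothesis.Theorems.WeilFormatC
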